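/- Copyright: ym3-torus cell, WIDTH-5 ATTACH seat `ym-ust-19936-w4` (prover, g10), for crux `HistoryTailL` (stmt-QuantumFields-19936),
level-0 prefactor-free infrastructure (T4-UP, bricks U2 + U3a) of LINE `local_insertion` (#13) ∕ K1.  Released under the licence of the
surrounding project. -/
import Summits.QuantumFields.YangMills.Theorems.LocalInsertionTorusTopLinkSharpD3
import Summits.QuantumFields.YangMills.Theorems.LangevinControlUVFemtoCurvatureTwoPointCTorusUpperAxis
import HarnessLib

/-!
# (T4-UP, U2 + U3a) The holonomy-conditioned upper bound on the THREE-torus: Stokes (every d), one-link updates, the sharp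
# family off the axes, the law of the axis holonomies — d = 3 ports of ✓`…CLatticeStokes` ∕ `…CTorusUpper` ∕ `…CTorusUpperAxis`

Support file (`--supports stmt-QuantumFields-19936 --as helper`), cell ym3-torus level-0 programme, stage (T4) «uniform doubling»
(LEAD ★w1-19936 g7; split ★w7 = T4-LOW, ★w4 = T4-UP).  The d = 4 route-`LangevinControlUV` files (crux 16204) prove the
holonomy-conditioned triangular UPPER bound `Z_L(b∕2) ≤ (C(b∕4)^{−D∕2})^{3L⁴−3}·Z₁(b∕(4L²))` on `GaugeConfig 4 L G`; their engine
`lintegral_mul_prod_le_pow_mul_lintegral` (triangular integration with a spectator), the skew-Haar lemmas and the `LatticeStokes.*`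
rectangle identities are dimension-generic and are IMPORTED; the `d`-specific letters are ported here to `d = 3`:

* `axisCommutatorCost_le_wilsonAction_general` — the lattice non-abelian Stokes bound `Σ_{μ<ν}(N − Re tr ρ[h_μ,h_ν]) ≤ L²·S(U)` for
  EVERY `d` (the d = 4 file's proof, verbatim);
* `TorusUpperD3.*` — `plaquetteHolonomy_update`, `plaquetteHolonomy_eq_of_eqOn`, `lintegral_update_plaquetteHolonomy` on `(ℤ∕L)³`;
* `OneSiteD3.*` — on `(ℤ∕1)³` Wilson's action is the commutator cost of the three links; `partitionFunction = ∫⁻`;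
* `torus_topLink_assignment_sharp_offAxis_d3` — U1b's sharp family (`#P + 2 = 2L³`) with the extra clause «no top link is an axis link»;
* `measurable_lineHolonomy_d3`, `lineHolonomy_zero_congr_axis_d3`, ★`map_axisHolonomy_pi_haar_d3` — the three based axis holonomies of a
  product-Haar configuration on `(ℤ∕L)³` are independent Haar elements.

The assembled bound `torus_upper_axisHolonomy_d3` is the sequel U3b.

HONEST SCOPE.  Ports of landed folklore (Haar invariance, finite combinatorics); no estimate of Bałaban's papers; nothing of (T4) as a
whole, of LINE #13's stubs, of `HistoryTailL` or of any crux is proved.  YM₃ on T³ is rung R3 — not d = 4, not infinite volume, not a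
mass gap, not Clay.
-/

set_option autoImplicit false

noncomputable section

open scoped ENNReal Matrix.Norms.Frobenius
open MeasureTheory Finset
open Literature.MathematicalPhysics.QuantumFieldTheory
open Summit.QuantumFields.YangMills.Theorems.FemtoCurvatureTwoPointC
open Summit.QuantumFields.YangMills.Theorems.FemtoCurvatureTwoPointC.TorusGauge
  (map_pi_haar_twoSided_eq pi_map_proj_eq_pi)
open Summit.QuantumFields.YangMills.Theorems.FemtoCurvatureTwoPointC.TorusGauge.TopLink (val_one_of_two_le val_add_one_of_lt)

namespace Summit.QuantumFields.YangMills.Theorems.LocalInsertion.TorusUpperAxisD3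

open Summit.QuantumFields.YangMills.Theorems.LocalInsertion.TorusTopLinkD3

-- adapted from Summits/QuantumFields/YangMills/Theorems/LangevinControlUVFemtoCurvatureTwoPointC{LatticeStokes,TorusUpper,TorusUpperAxis,CornerOneSite*}.lean (d = 4 → d = 3)

/-! ### The lattice Stokes bound, every dimension -/

open LatticeStokes in
/-- **THE LATTICE NON-ABELIAN STOKES BOUND, EVERY DIMENSION** (the `GaugeConfig d L G` form of ✓`axisCommutatorCost_le_wilsonAction`,
whose proof is `d`-generic): the commutator cost of the `d` based axis holonomies is at most `L²` times the Wilson action.** For every group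
`G`, every unitary matrix representation `ρ`, every torus `(ℤ/L)^d` and EVERY configuration `U` (no gauge
fixing), with `h_μ = lineHolonomy U μ L 0` the holonomy of the closed coordinate axis through `0`,

  `Σ_{μ<ν} (N − Re tr ρ(h_μ h_ν h_μ⁻¹ h_ν⁻¹)) ≤ L² · S(U)`.

Proof: `h_μ h_ν h_μ⁻¹ h_ν⁻¹` is the holonomy of the based `L × L` rectangle in the `(μ, ν)` plane
(`rectangleHolonomy_zero_self`); by the lattice non-abelian Stokes bound in trace form
(`sub_re_trace_map_rectangleHolonomy_le`) its cost is at most `L²` times the sum of the plaquette costs over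
the face, an injective sub-family of the `(μ, ν)` plaquettes of the torus (`sum_face_le_sum_site`); all plaquette
costs are non-negative, and summing over the planes gives `L² S(U)`. -/
theorem axisCommutatorCost_le_wilsonAction_general :
    ∀ {G : Type} [Group G] {N : ℕ} (ρ : G →* Matrix (Fin N) (Fin N) ℂ),
      (∀ g, ρ g ∈ Matrix.unitaryGroup (Fin N) ℂ) →
      ∀ {d L : ℕ} [NeZero L] (U : GaugeConfig d L G),
        ∑ q : {q : Fin d × Fin d // q.1 < q.2},
            ((N : ℝ) - (ρ (lineHolonomy U q.1.1 L 0 * lineHolonomy U q.1.2 L 0 *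
              (lineHolonomy U q.1.1 L 0)⁻¹ * (lineHolonomy U q.1.2 L 0)⁻¹)).trace.re) ≤
          (L : ℝ) ^ 2 * wilsonAction ρ U := by
  intro G _ N ρ hρ d L _ U
  have hq : ∀ q : {q : Fin d × Fin d // q.1 < q.2},
      (N : ℝ) - (ρ (lineHolonomy U q.1.1 L 0 * lineHolonomy U q.1.2 L 0 *
        (lineHolonomy U q.1.1 L 0)⁻¹ * (lineHolonomy U q.1.2 L 0)⁻¹)).trace.re ≤
        (L : ℝ) ^ 2 * ∑ y : Site d L, ((N : ℝ) - (ρ (plaquetteHolonomy U y q.1.1 q.1.2)).trace.re) := by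
    intro q
    rw [← rectangleHolonomy_zero_self]
    refine (sub_re_trace_map_rectangleHolonomy_le ρ hρ U q.1.1 q.1.2 L L 0).trans ?_
    rw [Nat.cast_mul, ← sq]
    refine mul_le_mul_of_nonneg_left ?_ (sq_nonneg _)
    simp only [zero_add]
    exact sum_face_le_sum_site (ne_of_lt q.2)
      (fun y => (N : ℝ) - (ρ (plaquetteHolonomy U y q.1.1 q.1.2)).trace.re) fun y => sub_re_trace_map_nonneg ρ hρ _
  refine (Finset.sum_le_sum fun q _ => hq q).trans_eq ?_
  rw [← Finset.mul_sum, wilsonAction, Fintype.sum_prod_type, Finset.sum_comm]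



/-! ### Updating one link of a plaquette on the torus `(ℤ/L)³` -/

namespace TorusUpperD3

section Holonomy

variable {L : ℕ} {G : Type*} [Group G]

/-- The plaquette holonomy `U(x,i) U(x+eᵢ,j) U(x+eⱼ,i)⁻¹ U(x,j)⁻¹` after updating one of its four links
(`i ≠ j`, `L ≥ 2`: the four links are pairwise distinct, so the other three factors are unchanged). -/
theorem plaquetteHolonomy_update (hL : 2 ≤ L) (x : Site 3 L) {i j : Fin 3} (hij : i ≠ j)
    (U : GaugeConfig 3 L G) (g : G) :
    plaquetteHolonomy (Function.update U (x, i) g) x i j =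
        g * U (x.shift i, j) * (U (x.shift j, i))⁻¹ * (U (x, j))⁻¹ ∧
    plaquetteHolonomy (Function.update U (x.shift i, j) g) x i j =
        U (x, i) * g * (U (x.shift j, i))⁻¹ * (U (x, j))⁻¹ ∧
    plaquetteHolonomy (Function.update U (x.shift j, i) g) x i j =
        U (x, i) * U (x.shift i, j) * g⁻¹ * (U (x, j))⁻¹ ∧
    plaquetteHolonomy (Function.update U (x, j) g) x i j =
        U (x, i) * U (x.shift i, j) * (U (x.shift j, i))⁻¹ * g⁻¹ := by
  have hx : ∀ k : Fin 3, x.shift k ≠ x := by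
    intro k h
    have h1 := congrFun h k
    rw [TopLink.shift_apply, if_pos rfl, add_eq_left] at h1
    have h2 := congrArg ZMod.val h1
    rw [val_one_of_two_le hL, ZMod.val_zero] at h2
    exact one_ne_zero h2
  have h12 : ((x, i) : Edge 3 L) ≠ (x.shift i, j) := fun h => hx i (Prod.ext_iff.1 h).1.symm
  have h13 : ((x, i) : Edge 3 L) ≠ (x.shift j, i) := fun h => hx j (Prod.ext_iff.1 h).1.symm
  have h14 : ((x, i) : Edge 3 L) ≠ (x, j) := fun h => hij (Prod.ext_iff.1 h).2
  have h23 : ((x.shift i, j) : Edge 3 L) ≠ (x.shift j, i) :=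
    fun h => hij ((Prod.ext_iff.1 h).2).symm
  have h24 : ((x.shift i, j) : Edge 3 L) ≠ (x, j) := fun h => hx i (Prod.ext_iff.1 h).1
  have h34 : ((x.shift j, i) : Edge 3 L) ≠ (x, j) := fun h => hx j (Prod.ext_iff.1 h).1
  simp only [plaquetteHolonomy, Function.update_self, Function.update_of_ne h12.symm,
    Function.update_of_ne h13.symm, Function.update_of_ne h14.symm, Function.update_of_ne h12,
    Function.update_of_ne h23.symm, Function.update_of_ne h24.symm, Function.update_of_ne h13,
    Function.update_of_ne h23, Function.update_of_ne h34.symm, Function.update_of_ne h14,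
    Function.update_of_ne h24, Function.update_of_ne h34, and_self]

/-- The plaquette holonomy depends only on the four links of the plaquette. -/
theorem plaquetteHolonomy_eq_of_eqOn (p : Plaquette 3 L) {U V : GaugeConfig 3 L G}
    (hUV : ∀ e ∈ ({(p.1, p.2.1.1), (p.1.shift p.2.1.1, p.2.1.2), (p.1.shift p.2.1.2, p.2.1.1),
      (p.1, p.2.1.2)} : Finset (Edge 3 L)), U e = V e) :
    plaquetteHolonomy U p.1 p.2.1.1 p.2.1.2 = plaquetteHolonomy V p.1 p.2.1.1 p.2.1.2 := by
  simp only [plaquetteHolonomy]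
  rw [hUV (p.1, p.2.1.1) (by simp), hUV (p.1.shift p.2.1.1, p.2.1.2) (by simp),
    hUV (p.1.shift p.2.1.2, p.2.1.1) (by simp), hUV (p.1, p.2.1.2) (by simp)]

variable [TopologicalSpace G] [IsTopologicalGroup G] [CompactSpace G] [MeasurableSpace G]
  [BorelSpace G]

/-- **Haar invariance over one link.** Integrating a measurable function of the plaquette holonomy
over ONE of the four link variables of the plaquette gives its Haar average: the holonomy of
`update U e g` is `a g b` or `a g⁻¹ b` with `a, b` independent of `g`, and the Haar probability measure
of a compact group is two-sided invariant and inversion invariant. -/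
theorem lintegral_update_plaquetteHolonomy {Φ : G → ℝ≥0∞} (hΦ : Measurable Φ) (hL : 2 ≤ L)
    (U : GaugeConfig 3 L G) (p : Plaquette 3 L) {e : Edge 3 L}
    (he : e ∈ ({(p.1, p.2.1.1), (p.1.shift p.2.1.1, p.2.1.2), (p.1.shift p.2.1.2, p.2.1.1),
      (p.1, p.2.1.2)} : Finset (Edge 3 L))) :
    ∫⁻ g, Φ (plaquetteHolonomy (Function.update U e g) p.1 p.2.1.1 p.2.1.2) ∂haarProbability G =
      ∫⁻ g, Φ g ∂haarProbability G := by
  obtain ⟨x, ⟨⟨i, j⟩, hij⟩⟩ := p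
  have hne : i ≠ j := ne_of_lt hij
  -- two-sided (`g ↦ a g b`) and twisted (`g ↦ a g⁻¹ b`) invariance of the Haar probability measure
  have hconj : ∀ a b : G, ∫⁻ g, Φ (a * g * b) ∂haarProbability G = ∫⁻ g, Φ g ∂haarProbability G :=
    fun a b => (WilsonGauge.measurePreserving_mul_mul a b).lintegral_comp hΦ
  have hconj_inv : ∀ a b : G,
      ∫⁻ g, Φ (a * g⁻¹ * b) ∂haarProbability G = ∫⁻ g, Φ g ∂haarProbability G :=
    fun a b => ((WilsonGauge.measurePreserving_mul_mul a b).comp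
      (Measure.measurePreserving_inv (haarProbability G))).lintegral_comp hΦ
  simp only [Finset.mem_insert, Finset.mem_singleton] at he
  rcases he with rfl | rfl | rfl | rfl
  · have hupd : ∀ g, plaquetteHolonomy (Function.update U (x, i) g) x i j =
        1 * g * (U (x.shift i, j) * (U (x.shift j, i))⁻¹ * (U (x, j))⁻¹) := fun g => by
      rw [(plaquetteHolonomy_update hL x hne U g).1]; group
    simp_rw [hupd]
    exact hconj _ _
  · have hupd : ∀ g, plaquetteHolonomy (Function.update U (x.shift i, j) g) x i j =
        U (x, i) * g * ((U (x.shift j, i))⁻¹ * (U (x, j))⁻¹) := fun g => by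
      rw [(plaquetteHolonomy_update hL x hne U g).2.1]; group
    simp_rw [hupd]
    exact hconj _ _
  · have hupd : ∀ g, plaquetteHolonomy (Function.update U (x.shift j, i) g) x i j =
        U (x, i) * U (x.shift i, j) * g⁻¹ * (U (x, j))⁻¹ := fun g =>
      (plaquetteHolonomy_update hL x hne U g).2.2.1
    simp_rw [hupd]
    exact hconj_inv _ _
  · have hupd : ∀ g, plaquetteHolonomy (Function.update U (x, j) g) x i j =
        U (x, i) * U (x.shift i, j) * (U (x.shift j, i))⁻¹ * g⁻¹ * 1 := fun g => by
      rw [(plaquetteHolonomy_update hL x hne U g).2.2.2, mul_one]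
    simp_rw [hupd]
    exact hconj_inv _ _

end Holonomy

end TorusUpperD3

/-! ### The one-site torus `(ℤ/1)³`: Wilson's action is the commutator cost; the partition function as `∫⁻` -/

namespace OneSiteD3

variable {G : Type*} [Group G]

/-- On `(ℤ/1)³` every plaquette holonomy is a group commutator `U(0,i) U(0,j) U(0,i)⁻¹ U(0,j)⁻¹`. -/
theorem plaquetteHolonomy_eq_commutator (U : GaugeConfig 3 1 G) (x : Site 3 1) (i j : Fin 3) :
    plaquetteHolonomy U x i j = U (0, i) * U (0, j) * (U (0, i))⁻¹ * (U (0, j))⁻¹ := by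
  rw [plaquetteHolonomy, Subsingleton.elim (x.shift i) (0 : Site 3 1), Subsingleton.elim (x.shift j) (0 : Site 3 1),
    Subsingleton.elim x (0 : Site 3 1)]

/-- **Wilson's action on `(ℤ/1)³` is the commutator cost** of the three links at `0` (three direction pairs). -/
theorem wilsonAction_eq_commutatorCost {N : ℕ} (ρ : G →* Matrix (Fin N) (Fin N) ℂ)
    (U : GaugeConfig 3 1 G) :
    wilsonAction ρ U = ∑ q : {q : Fin 3 × Fin 3 // q.1 < q.2},
      ((N : ℝ) - (ρ (U (0, q.1.1) * U (0, q.1.2) * (U (0, q.1.1))⁻¹ * (U (0, q.1.2))⁻¹)).trace.re) := by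
  unfold wilsonAction
  rw [Fintype.sum_prod_type, Fintype.sum_unique]
  simp only [plaquetteHolonomy_eq_commutator]

variable [TopologicalSpace G] [IsTopologicalGroup G] [CompactSpace G] [MeasurableSpace G] [BorelSpace G]
  {N : ℕ} (ρ : G →* Matrix (Fin N) (Fin N) ℂ)

/-- `Z(β) = ∫ e^{−βS} dHaar^{⊗E}` as a lower Lebesgue integral on `(ℤ/L)³` (definition unfolding). [folklore] -/
theorem partitionFunction_eq_lintegral' {L : ℕ} [NeZero L] (β : ℝ) :
    partitionFunction (d := 3) (L := L) ρ β =
      ∫⁻ U, ENNReal.ofReal (Real.exp (-β * wilsonAction ρ U))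
        ∂(Measure.pi fun _ : Edge 3 L => haarProbability G) := by
  simp only [partitionFunction, wilsonWeight, withDensity_apply _ MeasurableSet.univ,
    Measure.restrict_univ]

end OneSiteD3

/-! ### The sharp top-link family avoids the axis links -/

/-- A non-wrapping step in direction `μ` lands off the hyperplane `x_μ = 0`. -/
theorem shift_apply_self_ne_zero_d3 {L : ℕ} (hL : 2 ≤ L) {x : Site 3 L} {μ : Fin 3}
    (hx : (x μ).val + 1 < L) : x.shift μ μ ≠ 0 := by
  intro h
  rw [WilsonRP.shift_apply_self] at h
  have h2 := congrArg ZMod.val h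
  rw [val_add_one_of_lt hL hx, ZMod.val_zero] at h2
  exact Nat.succ_ne_zero _ h2

/-- **Sharp top-link assignment, off the axes**: the sharp family of `torus_topLink_assignment_sharp`
(`2L³ − 2` plaquettes, private top links of maximal rank), every top link `(y, μ)` having a non-zero
coordinate `y_ν`, `ν ≠ μ` (it is `(x + e_μ, ν)` or `(x + e_ν, μ)` with no wrap), hence never an axis link. -/
-- adapted from `torus_topLink_assignment_sharp` (`…CTorusTopLinkSharp` ∕ U1b d = 3 port)
theorem torus_topLink_assignment_sharp_offAxis_d3 (L : ℕ) [NeZero L] (hL : 2 ≤ L) :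
    ∃ (P : Finset (Plaquette 3 L)) (top : Plaquette 3 L → Edge 3 L) (rk : Edge 3 L → ℕ),
      Function.Injective rk ∧ Set.InjOn top ↑P ∧ P.card + 2 = 2 * L ^ 3 ∧
      ∀ p ∈ P,
        (top p ∈ ({(p.1, p.2.1.1), (p.1.shift p.2.1.1, p.2.1.2), (p.1.shift p.2.1.2, p.2.1.1),
          (p.1, p.2.1.2)} : Finset (Edge 3 L)) ∧
        ∀ e ∈ ({(p.1, p.2.1.1), (p.1.shift p.2.1.1, p.2.1.2), (p.1.shift p.2.1.2, p.2.1.1),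
          (p.1, p.2.1.2)} : Finset (Edge 3 L)), rk e ≤ rk (top p)) ∧
        ∃ ν : Fin 3, ν ≠ (top p).2 ∧ (top p).1 ν ≠ 0 := by
  classical
  obtain ⟨b, w, hrk, hw, hshift, hwrap⟩ := TopLinkSharp.exists_rank (L := L) hL
  obtain ⟨B, hB_mem, hB_card⟩ := TopLink.exists_boxes (L := L)
  obtain ⟨C, hC_mem, hC_card⟩ := TopLinkSharp.exists_wrapBoxes (L := L)
  refine ⟨(univ.filter fun p : Plaquette 3 L => p.1 ∈ B p.2.1.1) ∪
      (univ.filter fun p : Plaquette 3 L => p.1 ∈ C p.2.1.1 p.2.1.2),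
    fun p => if (p.1 p.2.1.1).val + 1 < L then (p.1.shift p.2.1.1, p.2.1.2)
      else (p.1.shift p.2.1.2, p.2.1.1),
    fun e => b e.1 + w e.2, hrk, TopLinkSharp.injOn_top hL hB_mem hC_mem, ?_, fun p hp => ?_⟩
  · rw [Finset.card_union_of_disjoint (Finset.disjoint_left.2 fun p hpA hpB =>
      ((hC_mem _ _ _ p.2.2).1 (Finset.mem_filter.1 hpB).2).1
        ((hB_mem _ _).1 (Finset.mem_filter.1 hpA).2).1)]
    have h1 := TopLink.card_family hB_card
    have h2 := TopLinkSharp.card_wrapFamily hC_card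
    omega
  · dsimp only
    by_cases h : (p.1 p.2.1.1).val + 1 < L
    · rw [if_pos h]
      exact ⟨⟨by simp, TopLinkSharp.rank_le_topA hw hshift hwrap h⟩, p.2.1.1, p.2.2.ne,
        shift_apply_self_ne_zero_d3 hL h⟩
    · rw [if_neg h]
      have hpB := (Finset.mem_union.1 hp).resolve_left fun hpA =>
        h ((hB_mem _ _).1 (Finset.mem_filter.1 hpA).2).1
      have hν : (p.1 p.2.1.2).val + 1 < L := ((hC_mem _ _ _ p.2.2).1 (Finset.mem_filter.1 hpB).2).2.1
      exact ⟨⟨by simp, TopLinkSharp.rank_le_topB hshift hwrap h hν⟩, p.2.1.2, p.2.2.ne',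
        shift_apply_self_ne_zero_d3 hL hν⟩

/-! ### The based axis holonomies and their law -/

section Axis

variable {L : ℕ} {G : Type*} [Group G]

/-- Straight-line holonomies are measurable in the configuration (finite ordered products of
coordinates). -/
theorem measurable_lineHolonomy_d3 [MeasurableSpace G] [MeasurableMul₂ G] (k : Fin 3) :
    ∀ (n : ℕ) (y : Site 3 L), Measurable fun U : GaugeConfig 3 L G => lineHolonomy U k n y
  | 0, _ => by simpa only [lineHolonomy] using measurable_const
  | n + 1, y => by
    simp only [lineHolonomy]
    exact (measurable_pi_apply _).mul (measurable_lineHolonomy_d3 k n _)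

/-- The based axis holonomy `lineHolonomy U μ n 0` only reads AXIS links: links `(y, μ)` whose base
point has `y_ν = 0` for all `ν ≠ μ`. -/
theorem lineHolonomy_zero_congr_axis_d3 {U V : GaugeConfig 3 L G} (μ : Fin 3) (n : ℕ)
    (h : ∀ e : Edge 3 L, (∀ ν : Fin 3, ν ≠ e.2 → e.1 ν = 0) → U e = V e) :
    lineHolonomy U μ n 0 = lineHolonomy V μ n 0 :=
  WilsonLoopRP.lineHolonomy_congr μ n 0 fun s _ => h _ fun ν hν => by
    simp [Pi.single_eq_of_ne hν]

variable [NeZero L] [TopologicalSpace G] [IsTopologicalGroup G] [CompactSpace G] [MeasurableSpace G]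
  [BorelSpace G]

/-- **The based axis holonomies of a product-Haar configuration are independent Haar elements**
(`L ≥ 2`): `h_μ = U(0, μ) · t_μ(U)` with the tail `t_μ` reading only links based OFF the origin, so the
skew product lemma `map_pi_haar_twoSided_eq` and the reindexing `pi_map_proj_eq_pi` apply. -/
theorem map_axisHolonomy_pi_haar_d3 {G : Type} [Group G] [TopologicalSpace G] [IsTopologicalGroup G]
    [CompactSpace G] [MeasurableSpace G] [BorelSpace G] [SecondCountableTopology G]
    (L : ℕ) [NeZero L] (hL : 2 ≤ L) :
    (Measure.pi fun _ : Edge 3 L => haarProbability G).map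
        (fun (U : GaugeConfig 3 L G) (e' : Edge 3 1) => lineHolonomy U e'.2 L 0) =
      Measure.pi fun _ : Edge 3 1 => haarProbability G := by
  classical
  obtain ⟨n, rfl⟩ : ∃ n, L = n + 1 := ⟨L - 1, by omega⟩
  -- the links based off the origin, and the tails of the axis holonomies
  let s : Finset (Edge 3 (n + 1)) := univ.filter fun e => e.1 ≠ 0
  let R : GaugeConfig 3 (n + 1) G → Edge 3 (n + 1) → G := fun U e =>
    if e.1 = 0 then lineHolonomy U e.2 n ((0 : Site 3 (n + 1)).shift e.2) else 1
  have hRm : ∀ e, Measurable fun U => R U e := by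
    intro e
    by_cases he : e.1 = 0
    · simp only [R, if_pos he]
      exact measurable_lineHolonomy_d3 _ _ _
    · simp only [R, if_neg he]
      exact measurable_const
  have hRs : ∀ U V : GaugeConfig 3 (n + 1) G, (∀ e ∈ s, U e = V e) → R U = R V := by
    intro U V hUV
    funext e
    by_cases he : e.1 = 0
    · simp only [R, if_pos he]
      refine WilsonLoopRP.lineHolonomy_congr e.2 n _ fun m hm =>
        hUV _ (Finset.mem_filter.2 ⟨Finset.mem_univ _, ?_⟩)
      -- the site `e_μ + m e_μ = (m + 1) e_μ` is not the origin (`m + 1 ≤ n < n + 1`)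
      show (0 : Site 3 (n + 1)).shift e.2 + Pi.single e.2 (m : ZMod (n + 1)) ≠ 0
      rw [WilsonLoopRP.shift_add_single, zero_add]
      intro h
      have h1 := congrFun h e.2
      rw [Pi.single_eq_same, Pi.zero_apply] at h1
      have h2 := congrArg ZMod.val h1
      rw [ZMod.val_natCast, Nat.mod_eq_of_lt (by omega), ZMod.val_zero] at h2
      omega
    · simp only [R, if_neg he]
  have hskew := map_pi_haar_twoSided_eq s (fun _ _ => (1 : G)) R (fun _ => measurable_const) hRm
    (fun _ _ _ => rfl) hRs
  -- reindex the links at the origin by `Edge 3 1`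
  let j : Edge 3 1 → {e : Edge 3 (n + 1) // e ∉ s} := fun e' =>
    ⟨((0 : Site 3 (n + 1)), e'.2), by simp [s]⟩
  have hj : Function.Injective j := fun e₁ e₂ h =>
    Prod.ext (Subsingleton.elim _ _) (congrArg (fun i : {e : Edge 3 (n + 1) // e ∉ s} => i.1.2) h)
  have hproj := pi_map_proj_eq_pi (haarProbability G) hj
  have hΦm : Measurable fun (U : GaugeConfig 3 (n + 1) G) (i : {e : Edge 3 (n + 1) // e ∉ s}) =>
      (1 : G) * U i * R U i :=
    measurable_pi_lambda _ fun i => (measurable_const.mul (measurable_pi_apply _)).mul (hRm _)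
  have hPm : Measurable fun (W : {e : Edge 3 (n + 1) // e ∉ s} → G) (e' : Edge 3 1) => W (j e') :=
    measurable_pi_lambda _ fun e' => measurable_pi_apply _
  -- the axis-holonomy map is the composite `projection ∘ skew translation`
  have hcomp : (fun (U : GaugeConfig 3 (n + 1) G) (e' : Edge 3 1) => lineHolonomy U e'.2 (n + 1) 0) =
      (fun (W : {e : Edge 3 (n + 1) // e ∉ s} → G) (e' : Edge 3 1) => W (j e')) ∘
        (fun (U : GaugeConfig 3 (n + 1) G) (i : {e : Edge 3 (n + 1) // e ∉ s}) =>
          (1 : G) * U i * R U i) := by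
    funext U e'
    simp only [Function.comp_apply, j, R, if_true, one_mul, lineHolonomy]
  rw [hcomp, ← Measure.map_map hPm hΦm, hskew, hproj]

end Axis

end Summit.QuantumFields.YangMills.Theorems.LocalInsertion.TorusUpperAxisD3

end
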